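import Summits.KontsevichZagierPeriods.KontsevichZagierPeriods.Theorems.SoloInformedSectorMap
import Summits.KontsevichZagierPeriods.KontsevichZagierPeriods.Theorems.SoloInformedAnNuPole
import HarnessLib

/-!
# Pull-back of a corner germ along a sector map

Solo programme `solo-KontsevichZagierPeriods-informed`, session s111, PRES-RAT(2) step (γ)-6.

For a `K`-polynomial `G` whose support has total degree `≥ m` (e.g. `m = mult_0 G`) and the
sector map `Φ = Φ_{κ,t,λ}` of `SoloInformedSectorMap`:

* `G(Φ x) = (κ x₀)^m · child_{t,κ,λ}(G)(x)` (`soloInformed_aeval_sectorMap`);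
* the two **gradient identities** obtained by differentiating along `x₁` and `x₀`:
  `(κ x₀)^m ∂₁G'(x) = κ x₀ λ · ∂₁G(Φ x)` and
  `(κ x₀)^m ∂₀G'(x) + m κ (κ x₀)^{m-1} G'(x) = κ ∂₀G(Φ x) + κ (t + λ x₁) ∂₁G(Φ x)`
  with `G' = child(G)`;
* consequently, off the exceptional edge a zero of `G'` is smooth iff its image is a smooth zero
  of `G` (`soloInformed_grad_childK_ne_zero`), and
* **finiteness of the singular set is inherited by children**
  (`soloInformed_singSet_childK_finite`): off the edge the singular zeros of `G'` map injectively
  into those of `G`, and on the edge `x₀ = 0` the zeros of `G'` are the roots of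
  `cone_G(t + λ x₁)`, finitely many as `cone_G ≠ 0`.

These are the facts that make "a child of a corner configuration is a corner configuration" work
in the vertex recursion.

References: this work (s107 `soloInformedChildK`, s111 `SoloInformedSectorMap`).
-/

open scoped BigOperators Topology
open MeasureTheory Set Filter Metric
open Literature.NumberTheory.Transcendental Literature.NumberTheory.Transcendental.KZ
open Literature.ModelTheory.ExponentialFields (IsSemialgebraic)

namespace Summit.KontsevichZagierPeriods.KontsevichZagierPeriods.Theorems

variable {K : Type*} [Field K] [Algebra K ℝ]

/-! ### The pull-back formula -/

/-- **Pull-back of `G` along the sector map**: `G(Φ x) = (κ x₀)^m · child(G)(x)`. -/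
theorem soloInformed_aeval_sectorMap (G : MvPolynomial (Fin 2) K) {m : ℕ}
    (hm : ∀ a ∈ G.support, m ≤ a 0 + a 1) (t κ lam : K) (x : Fin 2 → ℝ) :
    (MvPolynomial.aeval (soloInformedSectorMap (algebraMap K ℝ κ) (algebraMap K ℝ t)
        (algebraMap K ℝ lam) x) G : ℝ) =
      (algebraMap K ℝ κ * x 0) ^ m * MvPolynomial.aeval x (soloInformedChildK G m t κ lam) := by
  rw [soloInformed_aeval_childK]
  have h := soloInformed_aeval_lowerChart_eq_pow_mul_blowLowK G hm
    ![algebraMap K ℝ κ * x 0, algebraMap K ℝ t + algebraMap K ℝ lam * x 1]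
  simp only [Matrix.cons_val_zero, Matrix.cons_val_one] at h
  rw [← h]
  rfl

omit [Algebra K ℝ] in
/-- The support condition for `m = mult_0 G`. -/
theorem soloInformed_multK_le_of_mem_support (G : MvPolynomial (Fin 2) K) :
    ∀ a ∈ G.support, soloInformedMultK G ≤ a 0 + a 1 :=
  fun _ ha => soloInformed_multK_le ha

/-! ### The gradient identities -/

/-- The sector map along the `x₁`-direction is a line with direction `(0, κ x₀ λ)`. -/
theorem soloInformed_sectorMap_add_snd (κ t lam : ℝ) (x : Fin 2 → ℝ) (s : ℝ) :
    soloInformedSectorMap κ t lam (fun i => x i + s * (![0, 1] : Fin 2 → ℝ) i) =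
      fun i => soloInformedSectorMap κ t lam x i + s * (![0, κ * x 0 * lam] : Fin 2 → ℝ) i := by
  funext i
  fin_cases i
  · simp [soloInformedSectorMap]
  · simp [soloInformedSectorMap]
    ring

/-- The sector map along the `x₀`-direction is a line with direction `(κ, κ (t + λ x₁))`. -/
theorem soloInformed_sectorMap_add_fst (κ t lam : ℝ) (x : Fin 2 → ℝ) (s : ℝ) :
    soloInformedSectorMap κ t lam (fun i => x i + s * (![1, 0] : Fin 2 → ℝ) i) =
      fun i => soloInformedSectorMap κ t lam x i +
        s * (![κ, κ * (t + lam * x 1)] : Fin 2 → ℝ) i := by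
  funext i
  fin_cases i
  · simp [soloInformedSectorMap]
    ring
  · simp [soloInformedSectorMap]
    ring

/-- **Gradient identity in the `x₁`-direction**:
`(κ x₀)^m ∂₁(child G)(x) = κ x₀ λ · ∂₁G(Φ x)`. -/
theorem soloInformed_pderiv_one_childK_sectorMap (G : MvPolynomial (Fin 2) K) {m : ℕ}
    (hm : ∀ a ∈ G.support, m ≤ a 0 + a 1) (t κ lam : K) (x : Fin 2 → ℝ) :
    (algebraMap K ℝ κ * x 0) ^ m *
        (MvPolynomial.aeval x (MvPolynomial.pderiv 1 (soloInformedChildK G m t κ lam)) : ℝ) =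
      algebraMap K ℝ κ * x 0 * algebraMap K ℝ lam *
        MvPolynomial.aeval (soloInformedSectorMap (algebraMap K ℝ κ) (algebraMap K ℝ t)
          (algebraMap K ℝ lam) x) (MvPolynomial.pderiv 1 G) := by
  set z := soloInformedSectorMap (algebraMap K ℝ κ) (algebraMap K ℝ t) (algebraMap K ℝ lam) x
    with hz
  -- the function `s ↦ G(Φ(x + s e₁))`, differentiated in two ways at `s = 0`
  have hA := soloInformed_hasDerivAt_aevalK_line G z
    ![0, algebraMap K ℝ κ * x 0 * algebraMap K ℝ lam] 0
  have hB := (soloInformed_hasDerivAt_aevalK_line (soloInformedChildK G m t κ lam) x ![0, 1]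
    0).const_mul ((algebraMap K ℝ κ * x 0) ^ m)
  have hfg : (fun s : ℝ => (algebraMap K ℝ κ * x 0) ^ m * (MvPolynomial.aeval (fun i => x i +
      s * (![0, 1] : Fin 2 → ℝ) i) (soloInformedChildK G m t κ lam) : ℝ)) =
      fun s => (MvPolynomial.aeval (fun i => z i + s * (![0, algebraMap K ℝ κ * x 0 *
        algebraMap K ℝ lam] : Fin 2 → ℝ) i) G : ℝ) := by
    funext s
    rw [hz, ← soloInformed_sectorMap_add_snd, soloInformed_aeval_sectorMap G hm]
    simp
  rw [hfg] at hB
  have h := hB.unique hA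
  simp only [Fin.sum_univ_two, Matrix.cons_val_zero, Matrix.cons_val_one, zero_mul, add_zero,
    one_mul, zero_add] at h
  rw [h]

/-- **Gradient identity in the `x₀`-direction**:
`(κ x₀)^m ∂₀(child G)(x) + m κ (κ x₀)^{m-1} (child G)(x) = κ ∂₀G(Φ x) + κ (t + λ x₁) ∂₁G(Φ x)`. -/
theorem soloInformed_pderiv_zero_childK_sectorMap (G : MvPolynomial (Fin 2) K) {m : ℕ}
    (hm : ∀ a ∈ G.support, m ≤ a 0 + a 1) (t κ lam : K) (x : Fin 2 → ℝ) :
    (algebraMap K ℝ κ * x 0) ^ m *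
          (MvPolynomial.aeval x (MvPolynomial.pderiv 0 (soloInformedChildK G m t κ lam)) : ℝ) +
        m * algebraMap K ℝ κ * (algebraMap K ℝ κ * x 0) ^ (m - 1) *
          MvPolynomial.aeval x (soloInformedChildK G m t κ lam) =
      algebraMap K ℝ κ *
          MvPolynomial.aeval (soloInformedSectorMap (algebraMap K ℝ κ) (algebraMap K ℝ t)
            (algebraMap K ℝ lam) x) (MvPolynomial.pderiv 0 G) +
        algebraMap K ℝ κ * (algebraMap K ℝ t + algebraMap K ℝ lam * x 1) *
          MvPolynomial.aeval (soloInformedSectorMap (algebraMap K ℝ κ) (algebraMap K ℝ t)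
            (algebraMap K ℝ lam) x) (MvPolynomial.pderiv 1 G) := by
  set z := soloInformedSectorMap (algebraMap K ℝ κ) (algebraMap K ℝ t) (algebraMap K ℝ lam) x
    with hz
  have hA := soloInformed_hasDerivAt_aevalK_line G z
    ![algebraMap K ℝ κ, algebraMap K ℝ κ * (algebraMap K ℝ t + algebraMap K ℝ lam * x 1)] 0
  -- `s ↦ (κ (x₀ + s))^m`
  have hpow : HasDerivAt (fun s : ℝ => (algebraMap K ℝ κ * (x 0 + s)) ^ m)
      ((m : ℝ) * (algebraMap K ℝ κ * (x 0 + 0)) ^ (m - 1) * (algebraMap K ℝ κ * 1)) 0 :=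
    (((hasDerivAt_id (0 : ℝ)).const_add (x 0)).const_mul (algebraMap K ℝ κ)).pow m
  have hB := hpow.fun_mul
    (soloInformed_hasDerivAt_aevalK_line (soloInformedChildK G m t κ lam) x ![1, 0] 0)
  have hfg : (fun s : ℝ => (algebraMap K ℝ κ * (x 0 + s)) ^ m * (MvPolynomial.aeval (fun i =>
      x i + s * (![1, 0] : Fin 2 → ℝ) i) (soloInformedChildK G m t κ lam) : ℝ)) =
      fun s => (MvPolynomial.aeval (fun i => z i + s * (![algebraMap K ℝ κ, algebraMap K ℝ κ *
        (algebraMap K ℝ t + algebraMap K ℝ lam * x 1)] : Fin 2 → ℝ) i) G : ℝ) := by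
    funext s
    rw [hz, ← soloInformed_sectorMap_add_fst, soloInformed_aeval_sectorMap G hm]
    simp
  rw [hfg] at hB
  have h := hB.unique hA
  simp only [Fin.sum_univ_two, Matrix.cons_val_zero, Matrix.cons_val_one, zero_mul, add_zero,
    one_mul, mul_one] at h
  rw [← h]
  ring

/-! ### Smooth zeros off the edge -/

/-- **Smoothness transfers to children off the exceptional edge.**  At a point `x` with `x₀ ≠ 0`
where `child(G)` vanishes, if `∇G(Φ x) ≠ 0` then `∇ child(G)(x) ≠ 0` (for `κ, λ ≠ 0`). -/
theorem soloInformed_grad_childK_ne_zero (G : MvPolynomial (Fin 2) K) {m : ℕ}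
    (hm : ∀ a ∈ G.support, m ≤ a 0 + a 1) {t κ lam : K} (hκ : algebraMap K ℝ κ ≠ 0)
    (hlam : algebraMap K ℝ lam ≠ 0) {x : Fin 2 → ℝ} (hx : x 0 ≠ 0)
    (hG' : (MvPolynomial.aeval x (soloInformedChildK G m t κ lam) : ℝ) = 0)
    (hgrad : (MvPolynomial.aeval (soloInformedSectorMap (algebraMap K ℝ κ) (algebraMap K ℝ t)
        (algebraMap K ℝ lam) x) (MvPolynomial.pderiv 0 G) : ℝ) ≠ 0 ∨
      (MvPolynomial.aeval (soloInformedSectorMap (algebraMap K ℝ κ) (algebraMap K ℝ t)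
        (algebraMap K ℝ lam) x) (MvPolynomial.pderiv 1 G) : ℝ) ≠ 0) :
    (MvPolynomial.aeval x (MvPolynomial.pderiv 0 (soloInformedChildK G m t κ lam)) : ℝ) ≠ 0 ∨
      (MvPolynomial.aeval x (MvPolynomial.pderiv 1 (soloInformedChildK G m t κ lam)) : ℝ) ≠ 0
      := by
  by_contra hcon
  push Not at hcon
  obtain ⟨h0, h1⟩ := hcon
  have e1 := soloInformed_pderiv_one_childK_sectorMap G hm t κ lam x
  rw [h1, mul_zero] at e1
  have hd1 : (MvPolynomial.aeval (soloInformedSectorMap (algebraMap K ℝ κ) (algebraMap K ℝ t)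
      (algebraMap K ℝ lam) x) (MvPolynomial.pderiv 1 G) : ℝ) = 0 := by
    have hne : algebraMap K ℝ κ * x 0 * algebraMap K ℝ lam ≠ 0 :=
      mul_ne_zero (mul_ne_zero hκ hx) hlam
    exact (mul_eq_zero.1 e1.symm).resolve_left hne
  have e0 := soloInformed_pderiv_zero_childK_sectorMap G hm t κ lam x
  rw [h0, hG', hd1, mul_zero, mul_zero, mul_zero, add_zero, add_zero] at e0
  have hd0 : (MvPolynomial.aeval (soloInformedSectorMap (algebraMap K ℝ κ) (algebraMap K ℝ t)
      (algebraMap K ℝ lam) x) (MvPolynomial.pderiv 0 G) : ℝ) = 0 :=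
    (mul_eq_zero.1 e0.symm).resolve_left hκ
  rcases hgrad with h | h
  · exact h hd0
  · exact h hd1

/-! ### Finiteness of the singular set is inherited -/

/-- Values of a child on the exceptional edge: `child(G)(0, y) = cone_G(t + λ y)`. -/
theorem soloInformed_evalR_childK_edge (G : MvPolynomial (Fin 2) K) (m : ℕ) (t κ lam : K)
    (y : ℝ) :
    soloInformedEvalR (soloInformedChildK G m t κ lam) (0, y) =
      Polynomial.aeval (algebraMap K ℝ t + algebraMap K ℝ lam * y) (soloInformedConePolyK G m) := by
  rw [soloInformed_evalR_apply, soloInformed_aeval_childK, ← soloInformed_aeval_edge_blowLowK]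
  simp

/-- The real zero set of a non-zero `K`-polynomial in one variable is finite. -/
theorem soloInformed_finite_setOf_aeval_eq_zero {p : Polynomial K} (hp : p ≠ 0) :
    {r : ℝ | Polynomial.aeval r p = 0}.Finite := by
  have hp' : p.map (algebraMap K ℝ) ≠ 0 := by
    rwa [Ne, Polynomial.map_eq_zero_iff (algebraMap K ℝ).injective]
  refine (Polynomial.finite_setOf_isRoot hp').subset fun r hr => ?_
  rw [mem_setOf_eq, Polynomial.IsRoot.def, Polynomial.eval_map_algebraMap]
  exact hr

/-- **Finiteness of the singular set is inherited by children.**  If `Sing G` is finite,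
`cone_G ≠ 0` (as the `m`-cone), and `κ, λ ≠ 0`, then `Sing (child_{t,κ,λ} G)` is finite. -/
theorem soloInformed_singSet_childK_finite (G : MvPolynomial (Fin 2) K) {m : ℕ}
    (hm : ∀ a ∈ G.support, m ≤ a 0 + a 1) (hcone : soloInformedConePolyK G m ≠ 0) {t κ lam : K}
    (hκ : algebraMap K ℝ κ ≠ 0) (hlam : algebraMap K ℝ lam ≠ 0)
    (hfin : (soloInformedSingSet G).Finite) :
    (soloInformedSingSet (soloInformedChildK G m t κ lam)).Finite := by
  set κ' := algebraMap K ℝ κ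
  set t' := algebraMap K ℝ t
  set lam' := algebraMap K ℝ lam
  set G' := soloInformedChildK G m t κ lam with hG'
  -- the edge part
  have hA : {q : ℝ × ℝ | q.1 = 0 ∧ soloInformedEvalR G' q = 0}.Finite := by
    have hR := soloInformed_finite_setOf_aeval_eq_zero (K := K) hcone
    have hpre : ((fun y : ℝ => t' + lam' * y) ⁻¹' {r : ℝ | Polynomial.aeval r
        (soloInformedConePolyK G m) = 0}).Finite :=
      hR.preimage fun a _ b _ hab => mul_left_cancel₀ hlam (by simpa using hab)
    refine (hpre.image fun y : ℝ => ((0 : ℝ), y)).subset ?_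
    rintro ⟨a, b⟩ ⟨ha, hq⟩
    simp only at ha
    subst ha
    refine ⟨b, ?_, rfl⟩
    rw [mem_preimage, mem_setOf_eq, ← soloInformed_evalR_childK_edge G m t κ lam b]
    exact hq
  -- the part off the edge
  have hB : {q : ℝ × ℝ | q.1 ≠ 0 ∧ q ∈ soloInformedSingSet G'}.Finite := by
    refine (hfin.image fun z : ℝ × ℝ => (z.1 / κ', (z.2 / z.1 - t') / lam')).subset ?_
    rintro ⟨a, b⟩ ⟨ha, hq⟩
    simp only at ha
    obtain ⟨hq0, hq1, hq2⟩ := hq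
    rw [soloInformed_evalR_apply] at hq0 hq1 hq2
    simp only at hq0 hq1 hq2
    set x : Fin 2 → ℝ := ![a, b] with hx
    have hx0 : x 0 ≠ 0 := by simpa [hx] using ha
    have hz : soloInformedSectorMap κ' t' lam' x = ![κ' * a, κ' * a * (t' + lam' * b)] := by
      funext i; fin_cases i <;> simp [hx]
    -- the image point is a singular zero of `G`
    have e1 := soloInformed_pderiv_one_childK_sectorMap G hm t κ lam x
    rw [hq2, mul_zero] at e1
    have hd1 : (MvPolynomial.aeval (soloInformedSectorMap κ' t' lam' x) (MvPolynomial.pderiv 1 G)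
        : ℝ) = 0 :=
      (mul_eq_zero.1 e1.symm).resolve_left (mul_ne_zero (mul_ne_zero hκ hx0) hlam)
    have e0 := soloInformed_pderiv_zero_childK_sectorMap G hm t κ lam x
    rw [hq1, hq0, hd1, mul_zero, mul_zero, mul_zero, add_zero, add_zero] at e0
    have hd0 : (MvPolynomial.aeval (soloInformedSectorMap κ' t' lam' x) (MvPolynomial.pderiv 0 G)
        : ℝ) = 0 :=
      (mul_eq_zero.1 e0.symm).resolve_left hκ
    have hG0 : (MvPolynomial.aeval (soloInformedSectorMap κ' t' lam' x) G : ℝ) = 0 := by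
      rw [soloInformed_aeval_sectorMap G hm, hq0, mul_zero]
    rw [hz] at hd0 hd1 hG0
    refine ⟨(κ' * a, κ' * a * (t' + lam' * b)), ?_, ?_⟩
    · refine ⟨?_, ?_, ?_⟩ <;> rw [soloInformed_evalR_apply] <;> assumption
    · simp only [Prod.mk.injEq]
      constructor
      · field_simp
      · field_simp
        ring
  refine (hA.union hB).subset fun q hq => ?_
  by_cases h : q.1 = 0
  · exact Or.inl ⟨h, hq.1⟩
  · exact Or.inr ⟨h, hq⟩

end Summit.KontsevichZagierPeriods.KontsevichZagierPeriods.Theorems
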